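import Literature.NumberTheory.EllipticCurves.CongruentNumberNoncongruentFamilies
import Mathlib.Tactic.NormNum.LegendreSymbol
import Mathlib.Tactic.NormNum.Prime
import HarnessLib

/-!
# Lagrange 1975, §11: `rank E_{2pq}(ℚ) ≤ 1` for SYMBOLIC primes `p ≡ 5 (mod 8)`, `q ≡ 3 (mod 4)` (both signs of `(q/p)`), by complete `2`-descent

Topic `NumberTheory/EllipticCurves`; namespace `Literature.NumberTheory.EllipticCurves.CongruentNumberTwicePrimePair`
(continued from `CongruentNumberNoncongruentFamilies.lean` / `CongruentNumberLagrangeFamilies.lean`, whose descent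
set-up for `E_{2pq}` — `hsplit`, the seven sign/parity coordinates `ψ`, `ψ_T1/T2/T3`, `hker` — is reused verbatim);
machinery: `TwoDescentLinearConditions.mordellWeilRank_le_of_linear_conditions` [SilvermanAEC2009, Prop. X.1.4], the `I₀*`
condition `TwoDescentLocalI0.local_condition_I0` at `p`, `q` and the `2`-adic condition `TwoDescentLocalTwoCN.local_condition_two_cn`.

Source, verbatim. [Lagrange1975, §11, table p. 16-12] (J. Lagrange, *Nombres congruents et courbes elliptiques*, Sém.
Delange–Pisot–Poitou 16 (1974/75), exp. 16): for `n = 2pq`, `p ≡ −3 (mod 8)`, `q ≡ 3` or `−1 (mod 8)`, the first descent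
gives `Ḡ = {1}` and `G = {±1, ±p, ±2q, ±n}` when `(p/q) = −1` (resp. `G = {±1, ±q, ±2p, ±n}` when `(p/q) = +1`), i.e.
«`g ≤ 1`»: the rank is at most one. ([Monsky1990MockHeegner, Cor. 5.15 (2′)] prints `rank = 1`, `#Sel₂ = 8` for these `N`.)

PROVED here, for SYMBOLIC primes `p ≡ 5 (mod 8)`, `q ≡ 3 (mod 4)`, no condition on the symbol `(q/p) = (p/q)`:
`kill_53` — the `I₀*` conditions at `p`, `q` and the `2`-adic condition give FOUR independent linear conditions on the seven
coordinates (`κ₁ u t`, a `4 × 7` matrix in the two symbol bits `u = qrBit q 2`, `t = qrBit p q`; the solution space has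
dimension `3` for every `(u, t)`, `rows_53` by enumeration over `(ℤ/2)⁹`) — hence `mordellWeilRank_le_one_53 :
rk E_{2pq}(ℚ) ≤ 1` (`7 − 4 − 2`) and the instance-free `mordellWeilRank_le_one_congruentNumberCurve_two_mul_five_mul_three_mod_four`.
Instances (`30`, `70`, `174`: rank exactly `1`) are in the sequel `CongruentNumberEvenFiveThreeRankInstances.lean`; consumer:
the `𝒮⁻` enclosure of cell `bsd-monsky` (rank one from Tian's rational point alone). Everything is proved; no named facts.
-/

noncomputable section

namespace Literature.NumberTheory.EllipticCurves

namespace CongruentNumberTwicePrimePair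

open WeierstrassCurve WeierstrassCurve.Affine WeierstrassCurve.Affine.Point
open Literature.NumberTheory.EllipticCurves.KramerTwoDescent
open Literature.NumberTheory.EllipticCurves.TwoDescentLocal
open Literature.Barriers.BirchSwinnertonDyer.DokchitserDokchitser2011

variable {p q : ℕ} [hp : Fact p.Prime] [hq : Fact q.Prime]

/-- `p ∤ 1` (helpers repeated from `CongruentNumberNoncongruentFamilies.lean`, where they are private). [folklore] -/
private theorem p_ndvd_one : ¬ p ∣ 1 := fun h => hp.out.ne_one (Nat.dvd_one.mp h)

/-- `p ∤ 2ᵏ qʲ` for distinct primes `p ≠ 2`, `p ≠ q`. [folklore] -/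
private theorem p_ndvd (hp2 : p ≠ 2) (hpq : p ≠ q) (k j : ℕ) : ¬ p ∣ 2 ^ k * q ^ j := fun h => by
  rcases (Nat.Prime.dvd_mul hp.out).mp h with h | h
  · exact hp2 ((Nat.prime_dvd_prime_iff_eq hp.out Nat.prime_two).mp (hp.out.dvd_of_dvd_pow h))
  · exact hpq ((Nat.prime_dvd_prime_iff_eq hp.out hq.out).mp (hp.out.dvd_of_dvd_pow h))

/-- `(q : ℤ)` and `p` are coprime for distinct primes. [folklore] -/
private theorem gcd_q_p (hpq : p ≠ q) : (q : ℤ).gcd p = 1 := by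
  rw [Int.gcd_natCast_natCast]; exact (Nat.coprime_primes hq.out hp.out).mpr (Ne.symm hpq)

omit hq in
/-- `(2 : ℤ)` and an odd prime `p` are coprime. [folklore] -/
private theorem gcd_two_p (hp2 : p ≠ 2) : (2 : ℤ).gcd p = 1 := by
  rw [show (2 : ℤ) = ((2 : ℕ) : ℤ) from rfl, Int.gcd_natCast_natCast]
  exact (Nat.coprime_primes Nat.prime_two hp.out).mpr (Ne.symm hp2)

omit hp hq in
/-- `(2/p) = −1` for `p ≡ 5 (mod 8)`. [folklore] -/
private theorem jac_two_of_five (h8 : p % 8 = 5) : jacobiSym 2 p = -1 := by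
  rw [jacobiSym.at_two (Nat.odd_iff.mpr (by omega)), ZMod.χ₈_nat_eq_if_mod_eight]
  have h2 : p % 2 ≠ 0 := by omega
  have h17 : ¬ (p % 8 = 1 ∨ p % 8 = 7) := by omega
  simp only [h2, if_false, h17]

omit hp hq in
/-- `(−1/p) = 1` for `p ≡ 5 (mod 8)`. [folklore] -/
private theorem jac_neg_one_of_five (h8 : p % 8 = 5) : jacobiSym (-1) p = 1 := by
  rw [jacobiSym.at_neg_one (Nat.odd_iff.mpr (by omega)), ZMod.χ₄_nat_eq_if_mod_four]
  have h2 : p % 2 ≠ 0 := by omega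
  have h41 : p % 4 = 1 := by omega
  simp only [h2, if_false, h41, if_true]

omit hp hq in
/-- `(−1/q) = −1` for `q ≡ 3 (mod 4)`. [folklore] -/
private theorem jac_neg_one_of_three_mod_four (h4 : p % 4 = 3) : jacobiSym (-1) p = -1 := by
  rw [jacobiSym.at_neg_one (Nat.odd_iff.mpr (by omega)), ZMod.χ₄_nat_eq_if_mod_four]
  have h2 : p % 2 ≠ 0 := by omega
  have h41 : p % 4 ≠ 1 := by omega
  simp only [h2, if_false, h41]

/-! ## The four linear conditions, with the symbol bits `u = [(2/q) = −1]`, `t = [(q/p) = −1]` as parameters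
The `4 × 7` matrix `M u t` of the conditions on `ψ = (v₂(x+n), v_p(x+n), v_q(x+n), sign(x), v₂(x), v_p(x), v_q(x))`, `n = 2pq`,
is written out in every statement (no `def`: a pure proof file); `κ₁ u t := M u t ·`; kernel of dimension `3`, pivot
columns `0, 1, 2, 4` for every `(u, t)`. -/

/-- The pivot columns of `M u t` are `0, 1, 2, 4` for every `(u, t)`: an explicit preimage. [folklore] -/
private theorem κ₁_apply_pivot : ∀ (u t : ZMod 2) (w : Fin 4 → ZMod 2),
    (Matrix.mulVecLin (!![1, 0, 0, 1, 0, 1 + t, 1 + t; 0, 1, 0, 1, 0, (1 + u) * t, 1 + (1 + u) * t;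
      0, 0, 1, 1, 0, 1 + (1 + u) * (1 + t), (1 + u) * (1 + t); 0, 0, 0, 0, 1, 1 + t, t] :
        Matrix (Fin 4) (Fin 7) (ZMod 2))).toAddMonoidHom ![w 0, w 1, w 2, 0, w 3, 0, 0] = w := by
  decide

omit hp hq in
/-- `κ₁ u t` is onto. [folklore] -/
private theorem κ₁_surjective (u t : ZMod 2) : Function.Surjective
    (Matrix.mulVecLin (!![1, 0, 0, 1, 0, 1 + t, 1 + t; 0, 1, 0, 1, 0, (1 + u) * t, 1 + (1 + u) * t;
      0, 0, 1, 1, 0, 1 + (1 + u) * (1 + t), (1 + u) * (1 + t); 0, 0, 0, 0, 1, 1 + t, t] :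
        Matrix (Fin 4) (Fin 7) (ZMod 2))).toAddMonoidHom := fun w =>
  ⟨![w 0, w 1, w 2, 0, w 3, 0, 0], κ₁_apply_pivot u t w⟩

set_option synthInstance.maxSize 100000 in
set_option synthInstance.maxHeartbeats 400000 in
/-- `κ₁ u t` vanishes on vectors satisfying the four conditions. [folklore] -/
private theorem κ₁_eq_zero_of_rows (u t a2 ap aq s b2 bp bq : ZMod 2)
    (r0 : a2 + s + (1 + t) * bp + (1 + t) * bq = 0) (r1 : ap + s + (1 + u) * t * bp + (1 + (1 + u) * t) * bq = 0)
    (r2 : aq + s + (1 + (1 + u) * (1 + t)) * bp + (1 + u) * (1 + t) * bq = 0)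
    (r3 : b2 + (1 + t) * bp + t * bq = 0) :
    (Matrix.mulVecLin (!![1, 0, 0, 1, 0, 1 + t, 1 + t; 0, 1, 0, 1, 0, (1 + u) * t, 1 + (1 + u) * t;
      0, 0, 1, 1, 0, 1 + (1 + u) * (1 + t), (1 + u) * (1 + t); 0, 0, 0, 0, 1, 1 + t, t] :
        Matrix (Fin 4) (Fin 7) (ZMod 2))).toAddMonoidHom ![a2, ap, aq, s, b2, bp, bq] = 0 := by
  revert r0 r1 r2 r3 u t a2 ap aq s b2 bp bq
  decide

set_option synthInstance.maxSize 100000 in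
set_option synthInstance.maxHeartbeats 400000 in
/-- **The conditions at `p`, `q`, `2` for `n = 2pq`, `p ≡ 5 (8)`, `q ≡ 3 (4)`** (enumeration over `(ℤ/2)⁹`): the `I₀*`
classes at `p` (`(2/p) = −1`, `(−1/p) = 1`), at `q` (`(−1/q) = −1`) and the `2`-adic relation
`v₂(x+n) = sign(x) + v_q(x) + v₂(x)` (`χ₄(p) = 0`, `χ₄(q) = χ₄(pq) = 1`) imply the four rows of `M₁ u t`.
[cite: SilvermanAEC2009, Prop. X.1.4] -/
private theorem rows_53 (u t a2 ap aq s b2 bp bq : ZMod 2)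
    (Hp : (ap = 0 ∧ a2 * 1 + (aq * t + 0) = 0 ∧ bp = 0 ∧ s * 0 + (b2 * 1 + (bq * t + 0)) = 0) ∨
      (ap = 0 ∧ a2 * 1 + (aq * t + 0) = 1 ∧ bp = 1 ∧ s * 0 + (b2 * 1 + (bq * t + 0)) = 1 + t) ∨
      (ap = 1 ∧ a2 * 1 + (aq * t + 0) = 1 + t ∧ bp = 0 ∧ s * 0 + (b2 * 1 + (bq * t + 0)) = 0) ∨
      (ap = 1 ∧ a2 * 1 + (aq * t + 0) = t ∧ bp = 1 ∧ s * 0 + (b2 * 1 + (bq * t + 0)) = 1 + t))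
    (Hq : (aq = 0 ∧ a2 * u + (ap * t + 0) = 0 ∧ bq = 0 ∧ s * 1 + (b2 * u + (bp * t + 0)) = 0) ∨
      (aq = 0 ∧ a2 * u + (ap * t + 0) = u ∧ bq = 1 ∧ s * 1 + (b2 * u + (bp * t + 0)) = 1 + u + t) ∨
      (aq = 1 ∧ a2 * u + (ap * t + 0) = u + t ∧ bq = 0 ∧ s * 1 + (b2 * u + (bp * t + 0)) = 1) ∨
      (aq = 1 ∧ a2 * u + (ap * t + 0) = t ∧ bq = 1 ∧ s * 1 + (b2 * u + (bp * t + 0)) = u + t))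
    (H2 : a2 = s * 1 + (bp * 0 + (bq * 1 + 0)) + 1 * b2) :
    a2 + s + (1 + t) * bp + (1 + t) * bq = 0 ∧ ap + s + (1 + u) * t * bp + (1 + (1 + u) * t) * bq = 0 ∧
      aq + s + (1 + (1 + u) * (1 + t)) * bp + (1 + u) * (1 + t) * bq = 0 ∧ b2 + (1 + t) * bp + t * bq = 0 := by
  revert Hp Hq H2 u t a2 ap aq s b2 bp bq
  decide

/-! ## The descent -/

/-- **The local conditions at `p`, `q` and `2` hold on `E_{2pq}(ℚ)`** for `p ≡ 5 (mod 8)`, `q ≡ 3 (mod 4)`: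
`κ₁ u t ∘ ψ = 0` with `u = qrBit q 2`, `t = qrBit p q`. [cite: SilvermanAEC2009, Prop. X.1.4]
[cite: Lagrange1975, §11 table p. 16-12] -/
theorem kill_53 (h8p : p % 8 = 5) (h4q : q % 4 = 3)
    (P : (congruentNumberCurve (2 * (p * q))).toAffine.Point) (u t : ZMod 2) (hu : u = qrBit q ((2 : ℕ) : ℚ))
    (ht : t = qrBit p ((q : ℕ) : ℚ)) :
    (Matrix.mulVecLin (!![1, 0, 0, 1, 0, 1 + t, 1 + t; 0, 1, 0, 1, 0, (1 + u) * t, 1 + (1 + u) * t;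
      0, 0, 1, 1, 0, 1 + (1 + u) * (1 + t), (1 + u) * (1 + t); 0, 0, 0, 0, 1, 1 + t, t] :
        Matrix (Fin 4) (Fin 7) (ZMod 2))).toAddMonoidHom (ψ P) = 0 := by
  have hp2 : p ≠ 2 := by rintro rfl; norm_num at h8p
  have hq2 : q ≠ 2 := by rintro rfl; norm_num at h4q
  have hpq : p ≠ q := by rintro rfl; omega
  have hqp : q ≠ p := Ne.symm hpq
  have hp0 : (0 : ℚ) < p := Nat.cast_pos.mpr hp.out.pos
  have hq0 : (0 : ℚ) < q := Nat.cast_pos.mpr hq.out.pos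
  have hpq0 : (0 : ℚ) < (p : ℚ) * q := mul_pos hp0 hq0
  have hpr : p.Prime := hp.out
  have hqr : q.Prime := hq.out
  have hl2pq : ∀ a ∈ ([2, p, q] : List ℕ), a.Prime := by
    intro a ha
    simp only [List.mem_cons, List.not_mem_nil, or_false] at ha
    rcases ha with rfl | rfl | rfl
    exacts [Nat.prime_two, hpr, hqr]
  have hl22pq : ∀ a ∈ ([2, 2, p, q] : List ℕ), a.Prime := by
    intro a ha
    simp only [List.mem_cons, List.not_mem_nil, or_false] at ha
    rcases ha with rfl | rfl | rfl | rfl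
    exacts [Nat.prime_two, Nat.prime_two, hpr, hqr]
  -- the fixed symbols
  have jP2 := jac_two_of_five (p := p) h8p
  have jPm1 := jac_neg_one_of_five (p := p) h8p
  have jQm1 := jac_neg_one_of_three_mod_four (p := q) h4q
  have gqp := gcd_q_p (p := p) (q := q) hpq
  have gpq := gcd_q_p (p := q) (q := p) hqp
  have jP4 : jacobiSym ((2 : ℤ) ^ 2) p = 1 := jacobiSym.sq_one' (gcd_two_p (p := p) hp2)
  have jQ4 : jacobiSym ((2 : ℤ) ^ 2) q = 1 := jacobiSym.sq_one' (gcd_two_p (p := q) hq2)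
  have jPqq : jacobiSym ((q : ℤ) ^ 2) p = 1 := jacobiSym.sq_one' gqp
  have jQpp : jacobiSym ((p : ℤ) ^ 2) q = 1 := jacobiSym.sq_one' gpq
  have hQR : jacobiSym (p : ℤ) q = jacobiSym (q : ℤ) p :=
    jacobiSym.quadratic_reciprocity_one_mod_four (by omega) (Nat.odd_iff.mpr (by omega))
  -- the symbolic bits: `t = qrBit p q = qrBit q p` (reciprocity), `u = qrBit q 2`
  have cPm1 : qrBit p ((-1 : ℚ)) = 0 := qrBit_eq_zero_of_eq (p := p) 0 (-1) (by norm_num) jPm1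
  have cP2 : qrBit p (((2 : ℕ) : ℚ)) = 1 := qrBit_eq_one_of_eq (p := p) 0 (2) (by norm_num) jP2
  have cP2r : qrBit p (2 : ℚ) = 1 := qrBit_eq_one_of_eq (p := p) 0 (2) (by norm_num) jP2
  have cP4r : qrBit p (4 : ℚ) = 0 := qrBit_eq_zero_of_eq (p := p) 0 (2 ^ 2) (by norm_num) jP4
  have cQm1 : qrBit q ((-1 : ℚ)) = 1 := qrBit_eq_one_of_eq (p := q) 0 (-1) (by norm_num) jQm1
  have cQ4r : qrBit q (4 : ℚ) = 0 := qrBit_eq_zero_of_eq (p := q) 0 (2 ^ 2) (by norm_num) jQ4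
  have cQ2r : qrBit q (2 : ℚ) = qrBit q ((2 : ℕ) : ℚ) := by norm_cast
  have cQp : qrBit q ((p : ℕ) : ℚ) = qrBit p ((q : ℕ) : ℚ) := by
    rcases jacobiSym.eq_one_or_neg_one gqp with hσ | hσ
    · rw [qrBit_eq_zero_of_eq (p := p) 0 (q) (by norm_num) hσ,
        qrBit_eq_zero_of_eq (p := q) 0 (p) (by norm_num) (hQR.trans hσ)]
    · rw [qrBit_eq_one_of_eq (p := p) 0 (q) (by norm_num) hσ,
        qrBit_eq_one_of_eq (p := q) 0 (p) (by norm_num) (hQR.trans hσ)]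
  have hp0' : (p : ℚ) ≠ 0 := hp0.ne'; have hq0' : (q : ℚ) ≠ 0 := hq0.ne'
  -- the constants at `p`: `qrBit p (p^k · c) = qrBit p c`, then multiplicativity
  have cP0 : qrBit p ((-((2 * (p * q) : ℕ) : ℚ) - 0) * (-((2 * (p * q) : ℕ) : ℚ) - ((2 * (p * q) : ℕ) : ℚ))) = 1 :=
    qrBit_eq_one_of_eq (p := p) 2 (2 * 2 ^ 2 * q ^ 2) (by push_cast; ring)
      (by rw [jacobiSym.mul_left, jacobiSym.mul_left, jP2, jP4, jPqq]; norm_num)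
  have cP1 : qrBit p (-((2 * (p * q) : ℕ) : ℚ) - 0) = 1 + qrBit p ((q : ℕ) : ℚ) := by
    rw [show -((2 * (p * q) : ℕ) : ℚ) - 0 = (p : ℚ) * ((-1 : ℚ) * 2 * q) by push_cast; ring, qrBit_natCast_mul,
      qrBit_mul p (by norm_num) hq0', qrBit_mul p (by norm_num) (by norm_num), cPm1, cP2r, zero_add]
  have cP2' : qrBit p ((0 : ℚ) - -((2 * (p * q) : ℕ) : ℚ)) = 1 + qrBit p ((q : ℕ) : ℚ) := by
    rw [show (0 : ℚ) - -((2 * (p * q) : ℕ) : ℚ) = (p : ℚ) * ((2 : ℚ) * q) by push_cast; ring, qrBit_natCast_mul,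
      qrBit_mul p (by norm_num) hq0', cP2r]
  have cP3 : qrBit p (((0 : ℚ) - -((2 * (p * q) : ℕ) : ℚ)) * (0 - ((2 * (p * q) : ℕ) : ℚ))) = 0 :=
    qrBit_eq_zero_of_eq (p := p) 2 (-1 * 2 ^ 2 * q ^ 2) (by push_cast; ring)
      (by rw [jacobiSym.mul_left, jacobiSym.mul_left, jPm1, jP4, jPqq]; norm_num)
  have cP4 : qrBit p (((2 * (p * q) : ℕ) : ℚ) - -((2 * (p * q) : ℕ) : ℚ)) = qrBit p ((q : ℕ) : ℚ) := by
    rw [show ((2 * (p * q) : ℕ) : ℚ) - -((2 * (p * q) : ℕ) : ℚ) = (p : ℚ) * ((4 : ℚ) * q) by push_cast; ring,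
      qrBit_natCast_mul, qrBit_mul p (by norm_num) hq0', cP4r, zero_add]
  have cP5 : qrBit p (((2 * (p * q) : ℕ) : ℚ) - 0) = 1 + qrBit p ((q : ℕ) : ℚ) := by
    rw [show ((2 * (p * q) : ℕ) : ℚ) - 0 = (p : ℚ) * ((2 : ℚ) * q) by push_cast; ring, qrBit_natCast_mul,
      qrBit_mul p (by norm_num) hq0', cP2r]
  -- the constants at `q`
  have cQ0 : qrBit q ((-((2 * (p * q) : ℕ) : ℚ) - 0) * (-((2 * (p * q) : ℕ) : ℚ) - ((2 * (p * q) : ℕ) : ℚ))) =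
      qrBit q ((2 : ℕ) : ℚ) := by
    rw [show (-((2 * (p * q) : ℕ) : ℚ) - 0) * (-((2 * (p * q) : ℕ) : ℚ) - ((2 * (p * q) : ℕ) : ℚ)) =
        (q : ℚ) * ((q : ℚ) * ((2 : ℚ) * (4 * (p : ℚ) ^ 2))) by push_cast; ring, qrBit_natCast_mul,
      qrBit_natCast_mul, qrBit_mul q (by norm_num) (by positivity), qrBit_mul q (by norm_num) (by positivity), cQ4r,
      sq, qrBit_mul_self q _, cQ2r, add_zero, add_zero]
  have cQ1 : qrBit q (-((2 * (p * q) : ℕ) : ℚ) - 0) = 1 + qrBit q ((2 : ℕ) : ℚ) + qrBit p ((q : ℕ) : ℚ) := by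
    rw [show -((2 * (p * q) : ℕ) : ℚ) - 0 = (q : ℚ) * ((-1 : ℚ) * 2 * p) by push_cast; ring, qrBit_natCast_mul,
      qrBit_mul q (by norm_num) hp0', qrBit_mul q (by norm_num) (by norm_num), cQm1, cQ2r, cQp]
  have cQ2' : qrBit q ((0 : ℚ) - -((2 * (p * q) : ℕ) : ℚ)) = qrBit q ((2 : ℕ) : ℚ) + qrBit p ((q : ℕ) : ℚ) := by
    rw [show (0 : ℚ) - -((2 * (p * q) : ℕ) : ℚ) = (q : ℚ) * ((2 : ℚ) * p) by push_cast; ring, qrBit_natCast_mul,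
      qrBit_mul q (by norm_num) hp0', cQ2r, cQp]
  have cQ3 : qrBit q (((0 : ℚ) - -((2 * (p * q) : ℕ) : ℚ)) * (0 - ((2 * (p * q) : ℕ) : ℚ))) = 1 :=
    qrBit_eq_one_of_eq (p := q) 2 (-1 * 2 ^ 2 * p ^ 2) (by push_cast; ring)
      (by rw [jacobiSym.mul_left, jacobiSym.mul_left, jQm1, jQ4, jQpp]; norm_num)
  have cQ4 : qrBit q (((2 * (p * q) : ℕ) : ℚ) - -((2 * (p * q) : ℕ) : ℚ)) = qrBit p ((q : ℕ) : ℚ) := by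
    rw [show ((2 * (p * q) : ℕ) : ℚ) - -((2 * (p * q) : ℕ) : ℚ) = (q : ℚ) * ((4 : ℚ) * p) by push_cast; ring,
      qrBit_natCast_mul, qrBit_mul q (by norm_num) hp0', cQ4r, zero_add, cQp]
  have cQ5 : qrBit q (((2 * (p * q) : ℕ) : ℚ) - 0) = qrBit q ((2 : ℕ) : ℚ) + qrBit p ((q : ℕ) : ℚ) := by
    rw [show ((2 * (p * q) : ℕ) : ℚ) - 0 = (q : ℚ) * ((2 : ℚ) * p) by push_cast; ring, qrBit_natCast_mul,
      qrBit_mul q (by norm_num) hp0', cQ2r, cQp]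
  rcases TwoDescentLocal.point_cases hsplit P with rfl | rfl | rfl | rfl |
      ⟨x, y, hP, rfl, hx₁, hx₂, hx₃, hy, hsq⟩
  · rw [_root_.map_zero, _root_.map_zero]
  · rw [ψ_T1 hp2 hq2 hpq]; clear hu ht; revert u t; decide
  · rw [ψ_T2 hp2 hq2 hpq]; clear hu ht; revert u t; decide
  · rw [ψ_T3 hp2 hq2 hpq]; clear hu ht; revert u t; decide
  · simp only [cn_affine_a₁, cn_affine_a₃, zero_mul, add_zero, zero_div] at hy hsq
    rw [ψ_some hP hx₁ hx₂]
    obtain ⟨hd₁, hd₂, hd₃⟩ := sub_ne_zero_of_sq_eq hsq hy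
    have hsgn := signBit_sub_of_lt_of_lt hsq hy (by push_cast; linarith) (by push_cast; linarith)
    have e12 : (-((2 * (p * q) : ℕ) : ℚ)) - 0 = ((-(2 * p * q : ℤ) : ℤ) : ℚ) := by push_cast; ring
    have e13 : (-((2 * (p * q) : ℕ) : ℚ)) - ((2 * (p * q) : ℕ) : ℚ) = ((-(2 * 2 * p * q : ℤ) : ℤ) : ℚ) := by
      push_cast; ring
    have e21 : (0 : ℚ) - -((2 * (p * q) : ℕ) : ℚ) = (((2 * p * q : ℤ)) : ℚ) := by push_cast; ring
    have e23 : (0 : ℚ) - ((2 * (p * q) : ℕ) : ℚ) = ((-(2 * p * q : ℤ) : ℤ) : ℚ) := by push_cast; ring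
    have hev₁ : ∀ r : ℕ, r.Prime → r ∉ ([2, p, q] : List ℕ) →
        Even (padicValRat r (x - -((2 * (p * q) : ℕ) : ℚ))) := by
      intro r hr hrl
      haveI : Fact r.Prime := ⟨hr⟩
      refine Curve24A1.even_padicValRat_sub r (by push_cast; linarith) (by push_cast; linarith)
        ?_ ?_ hy hsq
      · rw [e12]
        exact padicValRat_eq_zero_of_eq_prod hr [2, p, q] hl2pq hrl
          (by simp [Int.natAbs_mul, Int.natAbs_neg]; ring)
      · rw [e13]
        exact padicValRat_eq_zero_of_eq_prod hr [2, 2, p, q] hl22pq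
          (fun h => hrl (by simp only [List.mem_cons, List.not_mem_nil, or_false] at h ⊢; tauto))
          (by simp [Int.natAbs_mul, Int.natAbs_neg]; ring)
    have hev₂ : ∀ r : ℕ, r.Prime → r ∉ ([2, p, q] : List ℕ) → Even (padicValRat r (x - 0)) := by
      intro r hr hrl
      haveI : Fact r.Prime := ⟨hr⟩
      refine Curve24A1.even_padicValRat_sub r (by push_cast; linarith) (by push_cast; linarith)
        ?_ ?_ hy
        (show y ^ 2 = (x - 0) * (x - -((2 * (p * q) : ℕ) : ℚ)) * (x - ((2 * (p * q) : ℕ) : ℚ)) by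
          rw [hsq]; ring)
      · rw [e21]
        exact padicValRat_eq_zero_of_eq_prod hr [2, p, q] hl2pq hrl (by simp [Int.natAbs_mul]; ring)
      · rw [e23]
        exact padicValRat_eq_zero_of_eq_prod hr [2, p, q] hl2pq hrl
          (by simp [Int.natAbs_mul, Int.natAbs_neg]; ring)
    have Hp := local_condition_I0 (p := p) hsq hy
      (padicValRat_eq_of_eq (p := p) 1 (u := 2 ^ 1 * q ^ 1) (v := 1) (-1) (Or.inr rfl) (p_ndvd hp2 hpq 1 1)
        p_ndvd_one (by push_cast; ring))
      (padicValRat_eq_of_eq (p := p) 1 (u := 2 ^ 2 * q ^ 1) (v := 1) (-1) (Or.inr rfl) (p_ndvd hp2 hpq 2 1)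
        p_ndvd_one (by push_cast; ring))
      (padicValRat_eq_of_eq (p := p) 1 (u := 2 ^ 1 * q ^ 1) (v := 1) (-1) (Or.inr rfl) (p_ndvd hp2 hpq 1 1)
        p_ndvd_one (by push_cast; ring))
    have Hq := local_condition_I0 (p := q) hsq hy
      (padicValRat_eq_of_eq (p := q) 1 (u := 2 ^ 1 * p ^ 1) (v := 1) (-1) (Or.inr rfl) (p_ndvd hq2 hqp 1 1)
        p_ndvd_one (by push_cast; ring))
      (padicValRat_eq_of_eq (p := q) 1 (u := 2 ^ 2 * p ^ 1) (v := 1) (-1) (Or.inr rfl) (p_ndvd hq2 hqp 2 1)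
        p_ndvd_one (by push_cast; ring))
      (padicValRat_eq_of_eq (p := q) 1 (u := 2 ^ 1 * p ^ 1) (v := 1) (-1) (Or.inr rfl) (p_ndvd hq2 hqp 1 1)
        p_ndvd_one (by push_cast; ring))
    have hl2q : ∀ a ∈ ([2, q] : List ℕ), a.Prime := by
      intro a ha
      simp only [List.mem_cons, List.not_mem_nil, or_false] at ha
      rcases ha with rfl | rfl
      exacts [Nat.prime_two, hqr]
    have hl2p : ∀ a ∈ ([2, p] : List ℕ), a.Prime := by
      intro a ha
      simp only [List.mem_cons, List.not_mem_nil, or_false] at ha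
      rcases ha with rfl | rfl
      exacts [Nat.prime_two, hpr]
    have memP : ∀ r : ℕ, r ∉ ([2, q] : List ℕ) → r ≠ p → r ∉ ([2, p, q] : List ℕ) := by
      intro r hrl hrp hm
      simp only [List.mem_cons, List.not_mem_nil, or_false] at hm hrl
      rcases hm with h | h | h
      · exact hrl (Or.inl h)
      · exact hrp h
      · exact hrl (Or.inr h)
    have memQ : ∀ r : ℕ, r ∉ ([2, p] : List ℕ) → r ≠ q → r ∉ ([2, p, q] : List ℕ) := by
      intro r hrl hrq hm
      simp only [List.mem_cons, List.not_mem_nil, or_false] at hm hrl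
      rcases hm with h | h | h
      · exact hrl (Or.inl h)
      · exact hrl (Or.inr h)
      · exact hrq h
    have BP₁ := qrBit_eq_signBit_add_listSum (p := p) hd₁ [2, q] (by simp [Ne.symm hq2]) hl2q
      (by simp [hp2, hpq]) (fun r hr hrl hrp => hev₁ r hr (memP r hrl hrp))
    have BP₂ := qrBit_eq_signBit_add_listSum (p := p) hd₂ [2, q] (by simp [Ne.symm hq2]) hl2q
      (by simp [hp2, hpq]) (fun r hr hrl hrp => hev₂ r hr (memP r hrl hrp))
    have BQ₁ := qrBit_eq_signBit_add_listSum (p := q) hd₁ [2, p] (by simp [Ne.symm hp2]) hl2p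
      (by simp [hq2, hqp]) (fun r hr hrl hrq => hev₁ r hr (memQ r hrl hrq))
    have BQ₂ := qrBit_eq_signBit_add_listSum (p := q) hd₂ [2, p] (by simp [Ne.symm hp2]) hl2p
      (by simp [hq2, hqp]) (fun r hr hrl hrq => hev₂ r hr (memQ r hrl hrq))
    simp only [List.map_cons, List.map_nil, List.sum_cons, List.sum_nil] at BP₁ BP₂ BQ₁ BQ₂
    -- `2`-adic condition: `m = pq ≡ 3 (mod 4)`
    have hm : Odd ((p : ℤ) * q) :=
      Int.odd_mul.mpr ⟨(Int.odd_coe_nat p).mpr (hpr.odd_of_ne_two hp2),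
        (Int.odd_coe_nat q).mpr (hqr.odd_of_ne_two hq2)⟩
    have H2 := local_condition_two_cn (m := (p : ℤ) * q) hm (n := ((2 * (p * q) : ℕ) : ℚ))
      (by push_cast; ring) hsq hy
    have C2 := chi4_eq_signBit_add_listSum hd₂ [p, q] (by simp [hpq])
      (by
        intro a ha
        simp only [List.mem_cons, List.not_mem_nil, or_false] at ha
        rcases ha with rfl | rfl
        exacts [hpr, hqr])
      (by simp [Ne.symm hp2, Ne.symm hq2])
      (fun r hr hrl hr2 => hev₂ r hr (fun hm' => by
        simp only [List.mem_cons, List.not_mem_nil, or_false] at hm' hrl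
        rcases hm' with h | h | h
        · exact hr2 h
        · exact hrl (Or.inl h)
        · exact hrl (Or.inr h)))
    simp only [List.map_cons, List.map_nil, List.sum_cons, List.sum_nil] at C2
    have k2_0 : chi4 (-1 : ℚ) = 1 := chi4_neg_one
    have k2_p : chi4 (((p : ℕ) : ℚ)) = 0 := chi4_eq_zero_of_eq 0 (p) (by norm_num) (by omega)
    have k2_q : chi4 (((q : ℕ) : ℚ)) = 1 := chi4_eq_one_of_eq 0 (q) (by norm_num) (by omega)
    have k2_m : chi4 (((p : ℤ) * q : ℤ) : ℚ) = 1 := by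
      refine chi4_eq_one_of_eq 0 ((p : ℤ) * q) (by norm_num) ?_
      have hp4 : (p : ℤ) % 4 = 1 := by omega
      have hq4 : (q : ℤ) % 4 = 3 := by omega
      rw [Int.mul_emod, hp4, hq4]; norm_num
    rw [k2_0, k2_p, k2_q] at C2
    rw [C2, k2_m] at H2
    rw [cP0, cP1, cP2', cP3, cP4, cP5] at Hp
    rw [cQ0, cQ1, cQ2', cQ3, cQ4, cQ5] at Hq
    rw [hsgn.1, zero_mul, zero_add, cP2] at BP₁
    rw [cPm1, cP2] at BP₂
    rw [hsgn.1, zero_mul, zero_add, cQp] at BQ₁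
    rw [cQm1, cQp] at BQ₂
    rw [BP₁, BP₂] at Hp
    rw [BQ₁, BQ₂] at Hq
    rw [← hu] at Hq
    rw [← ht] at Hp Hq
    have R := rows_53 u t (parityBit 2 (x - -((2 * (p * q) : ℕ) : ℚ)))
      (parityBit p (x - -((2 * (p * q) : ℕ) : ℚ))) (parityBit q (x - -((2 * (p * q) : ℕ) : ℚ)))
      (signBit (x - 0)) (parityBit 2 (x - 0)) (parityBit p (x - 0)) (parityBit q (x - 0)) Hp Hq H2
    exact κ₁_eq_zero_of_rows _ _ _ _ _ _ _ _ _ R.1 R.2.1 R.2.2.1 R.2.2.2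

/-- **`rk E_{2pq}(ℚ) ≤ 1` for primes `p ≡ 5 (mod 8)`, `q ≡ 3 (mod 4)`** — Lagrange's «`g ≤ 1`» for `n = 2pq`,
`p ≡ −3 (8)`, `q ≡ 3` or `−1 (8)` (either sign of `(p/q)`): seven coordinates, four independent conditions (`kill_53`),
`7 − 4 − 2 = 1`. [cite: Lagrange1975, §11 table p. 16-12] [cite: SilvermanAEC2009, Prop. X.1.4] -/
theorem mordellWeilRank_le_one_53 (h8p : p % 8 = 5) (h4q : q % 4 = 3) :
    (congruentNumberCurve (2 * (p * q))).mordellWeilRank ≤ 1 := by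
  have hp2 : p ≠ 2 := by rintro rfl; norm_num at h8p
  have hq2 : q ≠ 2 := by rintro rfl; norm_num at h4q
  have hpq : p ≠ q := by rintro rfl; omega
  refine mordellWeilRank_le_of_linear_conditions hsplit (N := 7) (k := 4) (s := 1) rfl ψ _ (hker hpq)
    (fun P => kill_53 h8p h4q P (qrBit q ((2 : ℕ) : ℚ)) (qrBit p ((q : ℕ) : ℚ)) rfl rfl)
    (κ₁_surjective (qrBit q ((2 : ℕ) : ℚ)) (qrBit p ((q : ℕ) : ℚ))) ?_ ?_ ?_ ?_
  · rw [ψ_T1 hp2 hq2 hpq]; decide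
  · rw [ψ_T2 hp2 hq2 hpq]; decide
  · rw [map_add, ψ_T1 hp2 hq2 hpq, ψ_T2 hp2 hq2 hpq]; decide
  · rw [ψ_T1 hp2 hq2 hpq, ψ_T2 hp2 hq2 hpq]; decide

end CongruentNumberTwicePrimePair

/-- **`rk E_{2pq}(ℚ) ≤ 1` for all primes `p ≡ 5 (mod 8)`, `q ≡ 3 (mod 4)`** (instance-free form of
`mordellWeilRank_le_one_53`; no condition on `(p/q)`). [cite: Lagrange1975, §11 table p. 16-12] [cite: SilvermanAEC2009, Prop. X.1.4] -/
theorem mordellWeilRank_le_one_congruentNumberCurve_two_mul_five_mul_three_mod_four {p q : ℕ} (hp : p.Prime)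
    (hq : q.Prime) (h8p : p % 8 = 5) (h4q : q % 4 = 3) :
    (congruentNumberCurve (2 * (p * q))).mordellWeilRank ≤ 1 :=
  haveI : Fact p.Prime := ⟨hp⟩
  haveI : Fact q.Prime := ⟨hq⟩
  CongruentNumberTwicePrimePair.mordellWeilRank_le_one_53 h8p h4q

end Literature.NumberTheory.EllipticCurves

end
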